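import Summits.QuantumFields.YangMills.Theorems.BalabanLadderUVSeamRecCeilingsSubGaussianCarrier
import Literature.Probability.LatticeModels.DiscreteGFFDirichletField
import Literature.Probability.LatticeModels.LatticeDirichletEnergy
import HarnessLib

/-!
# Crux `UVSeamRec` (stmt-QuantumFields-20043), free-field calibration of (RM), file 3a: linear statistics of the lattice GFF —
# variance = half the Coulomb energy, Gaussian generating function, and Hubbard–Stratonovich for UNBOUNDED (integrable) statistics

Helper file (`--supports stmt-QuantumFields-20043`) of the seam seat `ym-20043-seam-s2` (gen 3); theorems only, no definitions.

WHY.  The registered v5(α) stub `BirthV5A.stub_responseMomentsOdd6 : UV → (RM)` has the documented (β-cl) discharge architecture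
(split) + (EM_lin) + (HS): an extensive sub-Gaussian law in LINEAR sources for the response carrier, turned into joint exponential moments of
its SQUARE by the LEAD's Hubbard–Stratonovich press-button p544631 `TemperedResponse.integral_exp_mul_sum_sq_le_of_subGaussianLinear` — stated
there for BOUNDED statistics (compact configuration space).  The free-field calibration (series `…GaussianCalibrationKernel` / `…Energy` /
this file / `…GaussianCalibration`) runs the same architecture for the lattice GFF of `ℤ⁴` (tree `IsDiscreteGFF`, canonical space), whose linear
statistics are Gaussian, hence unbounded; this file supplies the probabilistic press-buttons in that setting:
* §1 `integral_exp_mul_sum_sq_le_of_subGaussianLinear_of_integrable` — p544631 with boundedness replaced by integrability of the linear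
  generating function (Tonelli on the Hubbard–Stratonovich product instead of domination), INCLUDING the integrability of `exp(λ Σ ℓ_i²)`;
* §2 linear statistics `φ ↦ Σ_{w∈S} a(w) φ_w` of the GFF: second moment `= ½·greenEnergy S a` (`latticeGreen/2` covariance), Gaussian law,
  generating function `∫ exp = exp(¼·greenEnergy S a)`, integrability;
* §3 `integral_exp_mul_sum_sq_le_of_sq_le` — for a finite family of linear statistics with the OPERATOR BOUND `∫ (Σ tᵢℓᵢ)² ≤ v·Σ tᵢ²`:
  `∫ exp(λ Σ ℓᵢ²) ≤ (2(1 − 2λv)^{-1/2})^{#ι}` (and integrability) — (EM_lin) ⇒ (EM_Q) in the free field.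

No sorry, standard axioms.  HONEST FRAMING: Gaussian calculus; a CALIBRATION tool for one OPEN binder of a CONDITIONAL chain; nothing of E0′,
not a gap, not Clay.  References: Hubbard–Stratonovich / sub-Gaussian squares (Vershynin 2018, Lemma 2.7.6); GFF covariance calculus
(Friedli–Velenik 2017, Ch. 8).
-/

set_option autoImplicit false

noncomputable section

open MeasureTheory ProbabilityTheory Finset
open Literature.Probability.LatticeModels
open Summit.QuantumFields.YangMills.Cruxes.UVSeamRec.TemperedResponse

namespace Summit.QuantumFields.YangMills.Cruxes.UVSeamRec.GaussianCalibration

/-! ## §1 Hubbard–Stratonovich for integrable (unbounded) linear statistics -/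

section HS

variable {ι : Type*} [Fintype ι]

/-- **Exponential moments of a sum of squares from an extensive sub-Gaussian linear-source bound — integrable version.**  As p544631
`integral_exp_mul_sum_sq_le_of_subGaussianLinear`, with the boundedness of the statistics `ℓ_i` replaced by the integrability of every
`exp(Σ_i t_i ℓ_i)`: if `∫ exp(Σ t_i ℓ_i) dμ ≤ exp(m Σ|t_i| + (v/2) Σ t_i²)` for all `t` (`μ` finite, `λ ≥ 0`, `2λv < 1`), then `exp(λ Σ_i ℓ_i²)` is
integrable and `∫ exp(λ Σ_i ℓ_i²) dμ ≤ (2 (1 − 2λv)^{-1/2} exp(λ m²/(1 − 2λv)))^{#ι}`.  Proof: Hubbard–Stratonovich `exp(λΣℓ²) = E_g exp(√(2λ)Σ gᵢℓᵢ)`,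
integrability on the product by Tonelli (inner integrals bounded by an integrable Gaussian function of `g`), Fubini. [folklore] -/
theorem integral_exp_mul_sum_sq_le_of_subGaussianLinear_of_integrable {Ω : Type*} [MeasurableSpace Ω] (μ : Measure Ω)
    [IsFiniteMeasure μ] (ℓ : ι → Ω → ℝ) (hℓm : ∀ i, Measurable (ℓ i))
    {m v lam : ℝ} (hlam : 0 ≤ lam) (h2 : 2 * lam * v < 1)
    (hint : ∀ t : ι → ℝ, Integrable (fun ω => Real.exp (∑ i, t i * ℓ i ω)) μ)
    (hlin : ∀ t : ι → ℝ, ∫ ω, Real.exp (∑ i, t i * ℓ i ω) ∂μ ≤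
      Real.exp (m * ∑ i, |t i| + v / 2 * ∑ i, (t i) ^ 2)) :
    Integrable (fun ω => Real.exp (lam * ∑ i, (ℓ i ω) ^ 2)) μ ∧
    ∫ ω, Real.exp (lam * ∑ i, (ℓ i ω) ^ 2) ∂μ ≤
      (2 * (Real.sqrt (1 / (1 - 2 * (lam * v))) * Real.exp (lam * m ^ 2 / (1 - 2 * (lam * v))))) ^
        Fintype.card ι := by
  set ν : Measure (ι → ℝ) := Measure.pi fun _ : ι => gaussianReal 0 1 with hν
  set c : ℝ := Real.sqrt (2 * lam) with hc
  have hc0 : 0 ≤ c := Real.sqrt_nonneg _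
  have hcsq : c ^ 2 = 2 * lam := Real.sq_sqrt (by positivity)
  have hlv : lam * v < 1 / 2 := by nlinarith
  set F : Ω → (ι → ℝ) → ℝ := fun ω g => Real.exp (∑ i, (c * ℓ i ω) * g i) with hF
  -- (1) pointwise HS identity
  have hHS : ∀ ω, Real.exp (lam * ∑ i, (ℓ i ω) ^ 2) = ∫ g, F ω g ∂ν := by
    intro ω
    rw [hF, hν, integral_exp_sum_mul_gaussianPi]
    congr 1
    rw [Finset.mul_sum]
    refine Finset.sum_congr rfl fun i _ => ?_
    rw [mul_pow, hcsq]; ring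
  have hFm : Measurable (Function.uncurry F) := by
    refine Real.measurable_exp.comp (Finset.measurable_sum _ fun i _ => ?_)
    exact (measurable_const.mul ((hℓm i).comp measurable_fst)).mul ((measurable_pi_apply i).comp measurable_snd)
  have hFpos : ∀ ω g, 0 < F ω g := fun ω g => Real.exp_pos _
  -- (2) the linear-source bound at t = c • g, and the sections
  have hF' : ∀ g ω, F ω g = Real.exp (∑ i, (c * g i) * ℓ i ω) := by
    intro g ω
    simp only [hF]
    exact congrArg Real.exp (Finset.sum_congr rfl fun i _ => by ring)
  set B : (ι → ℝ) → ℝ := fun g => Real.exp (∑ i, (m * c * |g i| + lam * v * (g i) ^ 2)) with hB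
  have hinner : ∀ g, ∫ ω, F ω g ∂μ ≤ B g := by
    intro g
    have h := hlin fun i => c * g i
    simp_rw [hF']
    refine h.trans (le_of_eq ?_)
    rw [hB]
    congr 1
    rw [Finset.mul_sum, Finset.mul_sum, ← Finset.sum_add_distrib]
    refine Finset.sum_congr rfl fun i _ => ?_
    rw [abs_mul, abs_of_nonneg hc0, mul_pow, hcsq]
    ring
  have hsec : ∀ g, Integrable (fun ω => F ω g) μ := by
    intro g
    have h := hint fun i => c * g i
    simp_rw [hF']
    exact h
  have hBint : Integrable B ν := by
    rw [hB, hν]; exact integrable_exp_sum_abs_gaussianPi hlv (fun _ => m * c)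
  -- (3) integrability on the product (Tonelli-type criterion)
  have hFint : Integrable (Function.uncurry F) (μ.prod ν) := by
    refine (integrable_prod_iff' hFm.aestronglyMeasurable).2 ⟨Filter.Eventually.of_forall hsec, ?_⟩
    have hmeas : AEStronglyMeasurable (fun g => ∫ ω, ‖Function.uncurry F (ω, g)‖ ∂μ) ν := by
      have : StronglyMeasurable (Function.uncurry fun ω g => ‖F ω g‖) :=
        (hFm.stronglyMeasurable.norm)
      exact this.integral_prod_left.aestronglyMeasurable
    refine Integrable.mono' hBint hmeas (Filter.Eventually.of_forall fun g => ?_)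
    have e1 : ∫ ω, ‖Function.uncurry F (ω, g)‖ ∂μ = ∫ ω, F ω g ∂μ :=
      integral_congr_ae (Filter.Eventually.of_forall fun ω => by
        simp only [Function.uncurry_apply_pair, Real.norm_eq_abs, abs_of_pos (hFpos ω g)])
    rw [Real.norm_eq_abs, e1, abs_of_nonneg (integral_nonneg fun ω => (hFpos ω g).le)]
    exact hinner g
  -- (4) Fubini and the Gaussian integral in g
  have hswap : ∫ ω, Real.exp (lam * ∑ i, (ℓ i ω) ^ 2) ∂μ = ∫ g, ∫ ω, F ω g ∂μ ∂ν := by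
    rw [← integral_integral_swap hFint]
    exact integral_congr_ae (Filter.Eventually.of_forall hHS)
  have hBval : ∫ g, B g ∂ν ≤
      (2 * (Real.sqrt (1 / (1 - 2 * (lam * v))) * Real.exp (lam * m ^ 2 / (1 - 2 * (lam * v))))) ^
        Fintype.card ι := by
    rw [hB, hν]
    simp_rw [Real.exp_sum]
    rw [integral_fintype_prod_eq_prod (f := fun i x => Real.exp (m * c * |x| + lam * v * x ^ 2)),
      ← Finset.card_univ, ← Finset.prod_const]
    refine Finset.prod_le_prod (fun i _ => integral_nonneg fun x => (Real.exp_pos _).le) fun i _ => ?_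
    have h1 := integral_exp_mul_abs_add_mul_sq_gaussianReal_le hlv (m * c)
    have hmc : (m * c) ^ 2 / (2 * (1 - 2 * (lam * v))) = lam * m ^ 2 / (1 - 2 * (lam * v)) := by
      rw [mul_pow, hcsq]
      have : (1 - 2 * (lam * v)) ≠ 0 := by linarith
      field_simp
    rw [hmc] at h1
    exact h1
  refine ⟨?_, ?_⟩
  · have h := hFint.integral_prod_left
    exact h.congr (Filter.Eventually.of_forall fun ω => (hHS ω).symm)
  · calc ∫ ω, Real.exp (lam * ∑ i, (ℓ i ω) ^ 2) ∂μ = ∫ g, ∫ ω, F ω g ∂μ ∂ν := hswap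
      _ ≤ ∫ g, B g ∂ν := integral_mono hFint.integral_prod_right hBint hinner
      _ ≤ _ := hBval

end HS

/-! ## §2 Linear statistics of the lattice GFF on the canonical space -/

section LinStat

variable {d : ℕ} {ν : Measure (Site d → ℝ)}

/-- A linear statistic `Σ_{w∈S} a(w) φ_w` is measurable. [folklore] -/
theorem measurable_linStat (S : Finset (Site d)) (a : Site d → ℝ) :
    Measurable fun φ : Site d → ℝ => ∑ w ∈ S, a w * φ w :=
  Finset.measurable_sum _ fun w _ => measurable_const.mul (measurable_pi_apply w)

/-- A linear statistic of the GFF has Gaussian law. [folklore] -/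
theorem hasGaussianLaw_linStat (hν : IsDiscreteGFF ν (coordProc d)) (S : Finset (Site d)) (a : Site d → ℝ) :
    HasGaussianLaw (fun φ : Site d → ℝ => ∑ w ∈ S, a w * φ w) ν := by
  have h := (hν.1.smul a).hasGaussianLaw_fun_sum (I := S)
  simpa [coordProc, smul_eq_mul] using h

/-- A linear statistic of the GFF is square integrable. [folklore] -/
theorem memLp_two_linStat (hν : IsDiscreteGFF ν (coordProc d)) (S : Finset (Site d)) (a : Site d → ℝ) :
    MemLp (fun φ : Site d → ℝ => ∑ w ∈ S, a w * φ w) 2 ν :=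
  (hasGaussianLaw_linStat hν S a).memLp_two

/-- A linear statistic of the GFF is centred. [folklore] -/
theorem integral_linStat (hν : IsDiscreteGFF ν (coordProc d)) (S : Finset (Site d)) (a : Site d → ℝ) :
    ∫ φ, ∑ w ∈ S, a w * φ w ∂ν = 0 := by
  rw [integral_finsetSum _ fun w _ => ((hν.1.hasGaussianLaw_eval w).integrable).const_mul _]
  refine Finset.sum_eq_zero fun w _ => ?_
  rw [integral_const_mul]
  simp [coordProc, hν.2.1 w]

/-- **Mixed second moment of two linear statistics**: `∫ (Σ_S a φ)(Σ_S b φ) dν = Σ_{x,y∈S} a(x) b(y) G(x−y)/2`. [cite: FriedliVelenik2017, Ch. 8 Prop. 8.7] -/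
theorem integral_linStat_mul_linStat (hν : IsDiscreteGFF ν (coordProc d)) (S : Finset (Site d)) (a b : Site d → ℝ) :
    ∫ φ, (∑ w ∈ S, a w * φ w) * (∑ w ∈ S, b w * φ w) ∂ν = ∑ x ∈ S, ∑ y ∈ S, a x * b y * (latticeGreen (x - y) / 2) := by
  have hint : ∀ x y : Site d, Integrable (fun φ : Site d → ℝ => a x * b y * (φ x * φ y)) ν :=
    fun x y => (hν.integrable_coord_mul x y).const_mul _
  have hexp : ∀ φ : Site d → ℝ, (∑ w ∈ S, a w * φ w) * (∑ w ∈ S, b w * φ w) =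
      ∑ x ∈ S, ∑ y ∈ S, a x * b y * (φ x * φ y) := by
    intro φ
    rw [Finset.sum_mul_sum]
    exact Finset.sum_congr rfl fun x _ => Finset.sum_congr rfl fun y _ => by ring
  simp_rw [hexp]
  rw [integral_finsetSum _ fun x _ => integrable_finsetSum _ fun y _ => hint x y]
  refine Finset.sum_congr rfl fun x _ => ?_
  rw [integral_finsetSum _ fun y _ => hint x y]
  refine Finset.sum_congr rfl fun y _ => ?_
  rw [integral_const_mul]
  simp [hν.2.2 x y]

/-- **Second moment of a linear statistic = half the Coulomb energy**: `∫ (Σ_{w∈S} a(w) φ_w)² dν = ½·greenEnergy S a`. [folklore] -/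
theorem integral_linStat_sq (hν : IsDiscreteGFF ν (coordProc d)) (S : Finset (Site d)) (a : Site d → ℝ) :
    ∫ φ, (∑ w ∈ S, a w * φ w) ^ 2 ∂ν = greenEnergy S a / 2 := by
  simp_rw [sq]
  rw [integral_linStat_mul_linStat hν S a a, greenEnergy, Finset.sum_div]
  refine Finset.sum_congr rfl fun x _ => ?_
  rw [Finset.sum_div]
  exact Finset.sum_congr rfl fun y _ => by ring

/-- The variance of a linear statistic is half its Coulomb energy. [folklore] -/
theorem variance_linStat (hν : IsDiscreteGFF ν (coordProc d)) (S : Finset (Site d)) (a : Site d → ℝ) :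
    Var[fun φ : Site d → ℝ => ∑ w ∈ S, a w * φ w; ν] = greenEnergy S a / 2 := by
  rw [variance_of_integral_eq_zero (measurable_linStat S a).aemeasurable (integral_linStat hν S a)]
  exact integral_linStat_sq hν S a

/-- **Gaussian generating function of a linear statistic**: `∫ exp(Σ_{w∈S} a(w) φ_w) dν = exp(¼·greenEnergy S a)` (`d ≥ 3`). [folklore] -/
theorem integral_exp_linStat (hν : IsDiscreteGFF ν (coordProc d)) (hd : 3 ≤ d) (S : Finset (Site d)) (a : Site d → ℝ) :
    ∫ φ, Real.exp (∑ w ∈ S, a w * φ w) ∂ν = Real.exp (greenEnergy S a / 4) := by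
  have hG := (hasGaussianLaw_linStat hν S a).map_eq_gaussianReal
  rw [integral_linStat hν S a, variance_linStat hν S a] at hG
  have h := mgf_gaussianReal hG 1
  simp only [mgf, one_mul, mul_one, one_pow, zero_add] at h
  rw [h, Real.coe_toNNReal _ (by linarith [greenEnergy_nonneg d hd S a])]
  ring_nf

/-- The exponential of a linear statistic is integrable (`d ≥ 3`). [folklore] -/
theorem integrable_exp_linStat (hν : IsDiscreteGFF ν (coordProc d)) (hd : 3 ≤ d) (S : Finset (Site d)) (a : Site d → ℝ) :
    Integrable (fun φ : Site d → ℝ => Real.exp (∑ w ∈ S, a w * φ w)) ν :=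
  Integrable.of_integral_ne_zero (by rw [integral_exp_linStat hν hd S a]; exact (Real.exp_pos _).ne')

end LinStat

/-! ## §3 (EM_lin) ⇒ (EM_Q) in the free field: exponential moments of squares of linear statistics under an operator bound -/

section Squares

variable {d : ℕ} {ν : Measure (Site d → ℝ)} {ι : Type*} [Fintype ι]

/-- **Joint exponential moments of squares of GFF linear statistics under an operator (variance) bound.**  Let `ℓ_i φ = Σ_{w∈S} a_i(w) φ_w`
(`i ∈ ι`, finite) be linear statistics of the lattice GFF (`d ≥ 3`) with `∫ (Σ_i t_i ℓ_i)² dν ≤ v · Σ_i t_i²` for every `t`.  Then for `λ ≥ 0` with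
`2λv < 1`, `exp(λ Σ_i ℓ_i²)` is integrable and `∫ exp(λ Σ_i ℓ_i²) dν ≤ (2 (1 − 2λv)^{-1/2})^{#ι}` (Gaussian generating function `exp(½ Var)` and
Hubbard–Stratonovich). [folklore] -/
theorem integral_exp_mul_sum_sq_le_of_sq_le (hν : IsDiscreteGFF ν (coordProc d)) (hd : 3 ≤ d) (S : Finset (Site d))
    (a : ι → Site d → ℝ) {v lam : ℝ} (hlam : 0 ≤ lam) (h2 : 2 * lam * v < 1)
    (hvar : ∀ t : ι → ℝ, ∫ φ, (∑ i, t i * ∑ w ∈ S, a i w * φ w) ^ 2 ∂ν ≤ v * ∑ i, (t i) ^ 2) :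
    Integrable (fun φ : Site d → ℝ => Real.exp (lam * ∑ i, (∑ w ∈ S, a i w * φ w) ^ 2)) ν ∧
    ∫ φ, Real.exp (lam * ∑ i, (∑ w ∈ S, a i w * φ w) ^ 2) ∂ν ≤
      (2 * Real.sqrt (1 / (1 - 2 * (lam * v)))) ^ Fintype.card ι := by
  have hP := hν.1.isProbabilityMeasure
  -- the linear statistic `Σ_i t_i ℓ_i` is itself a linear statistic with coefficients `Σ_i t_i a_i`
  have hlin_eq : ∀ (t : ι → ℝ) (φ : Site d → ℝ), ∑ i, t i * ∑ w ∈ S, a i w * φ w = ∑ w ∈ S, (∑ i, t i * a i w) * φ w := by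
    intro t φ
    simp_rw [Finset.mul_sum, Finset.sum_mul]
    rw [Finset.sum_comm]
    exact Finset.sum_congr rfl fun w _ => Finset.sum_congr rfl fun i _ => by ring
  have h := integral_exp_mul_sum_sq_le_of_subGaussianLinear_of_integrable ν (fun i φ => ∑ w ∈ S, a i w * φ w)
    (fun i => measurable_linStat S (a i)) (m := 0) (v := v) hlam h2 (fun t => ?_) (fun t => ?_)
  · simpa using h
  · simp_rw [hlin_eq t]
    exact integrable_exp_linStat hν hd S _
  · simp_rw [hlin_eq t]
    rw [integral_exp_linStat hν hd S, zero_mul, zero_add]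
    refine Real.exp_le_exp.2 ?_
    have h1 := hvar t
    simp_rw [hlin_eq t] at h1
    rw [integral_linStat_sq hν S] at h1
    linarith

end Squares

end Summit.QuantumFields.YangMills.Cruxes.UVSeamRec.GaussianCalibration

end
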